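import Literature.AnabelianGeometry.AbsoluteAnabelian.AbsTopIII.CuspidalCyclotomeKummerUnitsClosureRefutations
import Literature.AnabelianGeometry.AbsoluteAnabelian.AbsTopIII.KummerFaithfulPadicConsequences
import HarnessLib

/-!
# [AbsTopIII] Prop. 1.8 (ii) for Kummer classes of constants, relative to a `KummerCurveModel` (FACT-LIST
# F-0345): a NAMED toy carrier at which the premise FIRES, and the instance form there

S. Mochizuki, *Topics in Absolute Anabelian Geometry III* [AbsTopIII] (bib `MochizukiAbsTopIII2015`; kurims
manuscript `paper:url-5493eb38cbb7`), §1, Prop. 1.8 (ii) p. 36: "Suppose that there exist nonconstant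
NF-rational functions `∈ Γ(U, 𝒪_U^×)`. Then a class `η ∈ P_U ∩ H¹(G_k, M_X)` is the Kummer class of an
NF-constant `∈ k^×` if and only if there exist a nonconstant NF-rational function `f ∈ Γ(U, 𝒪_U^×)` and an
NF-point `x` [...] such that `κ_U(f)|_x = η|_{G_{k_x}}`" (printed proof p. 36 l. 42–50: value-surjectivity
`X_NF(k̄_NF) ↠ ℙ¹(k̄_NF)`).

Cell abc-iut, block F, seat abc-iut-f-071 gen 5, KEY «INST59G1».  `Prop_1_8_ii_units M` (abc-iut-L4-t1,
`CuspidalCyclotome.lean`, imported, never edited) is a NAMED FACT RELATIVE TO `M : KummerCurveModel`; its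
universal closure is REFUTED (`not_forall_prop_1_8_ii_units`: abc-iut-f-078's junk carrier
`KummerUnitsClosureWitness.model ℚ_2`, where `IsNFConstant := False`), and at the tree's other named carrier
`CurveModelSchemaWitness.toyKummerModel k` (`K_U := k`) the row holds only PREMISE-DEGENERATELY (no nonconstant
unit; `prop_1_8_ii_units_toyKummerModel`, this seat).  THIS FILE declares the toy carrier at which the premise
fires and the row holds:

* `KummerUnitsNFToyCarrier.model k` — f-078's junk data verbatim (one curve over `k`, `Π := G_k × Ẑ ↠ G_k`
  with `Ẑ = ∏_p ℤ_p`, one rational cusp with `I = Δ ≅ Ẑ` — a cyclotome presentation —, `K_U := k(X)`,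
  `Γ(U, 𝒪_U^×) := K_U^×`, `κ_U := 1`, one closed point `y` with `D_y := Π`, every NF-flag `True`) EXCEPT
  `IsNFConstant := True` (every constant is declared an NF-constant — genuine when `k` is a number field);
* `KummerUnitsNFToyCarrier.prop_1_8_ii_units k` — **F-0345, instance form, 0 hypotheses, head = the decl**:
  at this carrier both sides of the displayed equivalence hold for every constant `c` (`IsNFConstant c`;
  and `f := X`, `y :=` the point: `X` is a nonconstant NF-rational unit and `κ_U(X)|_y = 0 = κ_U(c)|_y`);
* `KummerUnitsNFToyCarrier.binders_rat` — at `k = ℚ` EVERY binder fires: cofinite opens, scheme flag, the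
  cyclotome presentation, `IsKummerFaithful ℚ` (`isKummerFaithful_rat`), all cusps rational, `IsNFCurve`, the
  PREMISE (the nonconstant NF-rational unit `X`), an NF-point, and the constant binder `c ∈ ℚ^×` with `hc`;
* `KummerUnitsNFToyCarrier.not_prop_1_6_iii_units` / `not_prop_1_8_i_units` — at the same carrier F-0343 and
  F-0344 FAIL over a Kummer-faithful base (f-078's mechanism: `κ_U(X) = 0`): with a TRIVIAL Kummer map the three
  rows cannot hold together non-degenerately — (iii)/(1.8 i) need `κ_U(g) ≠ 0` somewhere for a nonconstant `g`.

HONEST LABEL — TOY CARRIER, DEGENERATE IN THE KUMMER DATUM: `κ_U := 1`, so the equation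
`κ_U(f)|_x = η|_{G_{k_x}}` of print holds trivially (`0 = 0`) and the instance certifies only that OUR typed
schema is satisfiable with every binder firing; the printed content (Kummer classes of NF-constants are
DETECTED by values of nonconstant functions at NF-points) is absent.  WHY NO BETTER NAMED INSTANCE: a carrier
where the equation has content needs non-zero classes in Mathlib's `continuousCohomology 1` of the conjugation
representation on `geomCyclotome` and their restrictions to decomposition groups — the genuine étale-`π₁` Kummer
map of a hyperbolic curve ([AbsTopIII] Def. 1.5, [Mzk19] §2), not constructed in the tree at any named `def`.
Refereed results typed statements-first (D-0014); typed ≠ proved; an instance form about OUR typed statement ≠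
the printed theorem; nothing here bears on [IUTchIII] Cor. 3.12 or asserts that abc is proved or refuted; no
side taken.  No `instance`, no notation, no new named fact.  Axioms standard.
-/

noncomputable section

open CategoryTheory

namespace Literature.AnabelianGeometry.AbsoluteAnabelian.AbsTopIII

namespace KummerUnitsNFToyCarrier

open KummerUnitsClosureWitness

variable (k : Type) [Field k] [CharZero k]

/-- **TOY CARRIER for F-0345**: abc-iut-f-078's junk Kummer data over `k` (`Π = G_k × Ẑ`, one rational cusp
with `I = Δ ≅ Ẑ`, `K_U = k(X)`, all units regular, `κ_U := 1`, one closed point with `D := Π`) with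
`IsNFConstant := True`.  Not a model of any curve. [cite: MochizukiAbsTopIII2015, Prop 1.8 (ii) p.36] -/
def model : KummerCurveModel.{0} where
  Curve := PUnit
  base := fun _ => k
  instField := fun _ => inferInstance
  instCharZero := fun _ => inferInstance
  ext := fun _ => KummerUnitsClosureWitness.ext k
  galIso := fun _ => Iso.refl _
  cusps := fun _ => KummerUnitsClosureWitness.cusps k
  IsProper := fun _ => True
  IsScheme := fun _ => True
  genus := fun _ => 0
  FunctionField := fun _ => RatFunc k
  instFunctionField := fun _ => inferInstance
  instAlgebra := fun _ => inferInstance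
  Point := fun _ => PUnit
  decomp := fun _ _ => ⊤
  IsNFCurve := fun _ => True
  IsNFPoint := fun _ _ => True
  IsNFRational := fun _ _ => True
  IsNFConstant := fun _ _ => True
  NFFunctionField := fun _ => k
  instNFFunctionField := fun _ => inferInstance
  IsStrictlyBelyiType := fun _ => True
  IsCofiniteOpen := fun _ _ => True
  res := fun _ => KummerUnitsClosureWitness.resHom k
  regularUnits := fun _ => ⊤
  kummer := fun _ _ => 1

/-- Every cusp of the carrier is rational (`D_x = Π ↠ G_k`). [cite: MochizukiAbsTopIII2015, Prop 1.6 (ii) p.35] -/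
theorem isRational (U : (model k).Curve) (c : ((model k).cusps U).Cusp) : ((model k).cusps U).IsRational c :=
  fun g _ => ⟨(g, 1), Subgroup.mem_top _, rfl⟩

/-- `(U_x ⊆ X, x)` is a cyclotome presentation at the carrier (f-078's computation: cuspidal kernel `= Δ = I_x`
`≅ Ẑ`, `[N, Δ]⁻ = 1`). [cite: MochizukiAbsTopIII2015, Prop 1.4 (ii) p.31] -/
theorem isCyclotomePresentation (Ux X : (model k).Curve) (h : (model k).IsCofiniteOpen Ux X)
    (x : ((model k).cusps Ux).Cusp) : (model k).IsCyclotomePresentation h x where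
  isScheme := ⟨trivial, trivial⟩
  isProper := trivial
  isRational := isRational k Ux x
  isFreeProcyclic := isFreeProcyclic_geom k
  kernel_eq := by
    change cuspidalKernel (resHom k) =
      (Subgroup.normalClosure ((KummerUnitsClosureWitness.ext k).geom :
        Set (KummerUnitsClosureWitness.ext k).arith)).topologicalClosure
    rw [cuspidalKernel_resHom, topologicalClosure_normalClosure_geom]
  isCuspidallyCentral := by
    change IsCuspidallyCentralExtension (resHom k) (KummerUnitsClosureWitness.ext k).geom
    refine ⟨?_, ?_⟩
    · rw [cuspidallyCentralModulus_resHom, inf_bot_eq]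
    · rw [cuspidallyCentralModulus_resHom, cuspidalKernel_resHom, sup_bot_eq]

/-- The Kummer map of the carrier is trivial. [cite: MochizukiAbsTopIII2015, Prop 1.6 p.34] -/
theorem toAdd_kummer {U Ux X : (model k).Curve} (h₁ : (model k).IsCofiniteOpen U Ux)
    (h₂ : (model k).IsCofiniteOpen Ux X) (f : (model k).regularUnits U) :
    Multiplicative.toAdd ((model k).kummer h₁ h₂ f) = 0 :=
  rfl

/-- The regular unit `X ∈ k(X)^×` of the carrier. [cite: MochizukiAbsTopIII2015, Prop 1.6 p.34] -/
def unitX (U : (model k).Curve) : (model k).regularUnits U :=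
  ⟨Units.mk0 (RatFunc.X : RatFunc k) RatFunc.X_ne_zero, Subgroup.mem_top _⟩

variable {k} in
/-- `X` is nonconstant (f-078's `unitX_not_mem_range`, same datum). [cite: MochizukiAbsTopIII2015, Prop 1.6 (iii) p.35] -/
theorem unitX_not_mem_range (U : (model k).Curve) :
    (((unitX k U : (model k).regularUnits U) : ((model k).FunctionField U)ˣ) : (model k).FunctionField U)
      ∉ Set.range (algebraMap ((model k).base U) ((model k).FunctionField U)) :=
  KummerUnitsClosureWitness.unitX_not_mem_range

/-- **The premise of Prop. 1.8 (ii) FIRES at the carrier**: `X` is a nonconstant NF-rational regular unit.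
[cite: MochizukiAbsTopIII2015, Prop 1.8 (ii) p.36] -/
theorem exists_nonconstant_unit (U : (model k).Curve) :
    ∃ g : (model k).regularUnits U,
      (model k).IsNFRational U (((g : ((model k).FunctionField U)ˣ)) : (model k).FunctionField U) ∧
        (((g : ((model k).FunctionField U)ˣ)) : (model k).FunctionField U)
          ∉ Set.range (algebraMap ((model k).base U) ((model k).FunctionField U)) :=
  ⟨unitX k U, trivial, unitX_not_mem_range U⟩

/-- **F-0345 `Prop_1_8_ii_units`, INSTANCE FORM at the premise-firing toy carrier** (0 hypotheses; head = the
decl): for every constant `c`, `IsNFConstant c` holds, and `f := X`, `y :=` the closed point give a nonconstant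
NF-rational unit and an NF-point with `κ_U(X)|_y = 0 = κ_U(c)|_y` (DEGENERATE in the Kummer datum `κ_U := 1`).
[cite: MochizukiAbsTopIII2015, Prop 1.8 (ii) p.36] -/
theorem prop_1_8_ii_units : Prop_1_8_ii_units (model k) := by
  intro U Ux X h₁ h₂ x _ _ _ _ _ _ c hc
  exact ⟨fun _ => ⟨unitX k U, PUnit.unit, trivial, unitX_not_mem_range U, trivial, rfl⟩, fun _ => trivial⟩

/-- **F-0345 over `ℚ` (closed instance).** [cite: MochizukiAbsTopIII2015, Prop 1.8 (ii) p.36] -/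
theorem prop_1_8_ii_units_rat : Prop_1_8_ii_units (model ℚ) :=
  prop_1_8_ii_units ℚ

/-- **F-0345 over `ℚ_p` (closed instance).** [cite: MochizukiAbsTopIII2015, Prop 1.8 (ii) p.36] -/
theorem prop_1_8_ii_units_padic (p : ℕ) [Fact p.Prime] : Prop_1_8_ii_units (model ℚ_[p]) :=
  prop_1_8_ii_units ℚ_[p]

/-- **Every binder of F-0345 fires at the carrier over `ℚ`**: for all curves `U, U_x, X` (there is one), every
cusp `x` and every constant `c ∈ ℚ^×`: `U ⊆ U_x ⊆ X` cofinite opens, `U` scheme-like, `(U_x ⊆ X, x)` a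
cyclotome presentation, `ℚ` Kummer-faithful (`isKummerFaithful_rat`), all cusps of `U` rational, `U` an
NF-curve, the PREMISE (a nonconstant NF-rational regular unit), `c` mapped into the regular units (`hc`), and
an NF-point exists. [cite: MochizukiAbsTopIII2015, Prop 1.8 (ii) p.36] -/
theorem binders_rat :
    ∀ (U Ux X : (model ℚ).Curve) (x : ((model ℚ).cusps Ux).Cusp) (c : ((model ℚ).base U)ˣ),
      (model ℚ).IsCofiniteOpen U Ux ∧ (model ℚ).IsCofiniteOpen Ux X ∧ (model ℚ).IsScheme U ∧
        (model ℚ).IsCyclotomePresentation (Ux := Ux) (X := X) trivial x ∧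
        IsKummerFaithful ((model ℚ).base U) ∧
        (∀ c : ((model ℚ).cusps U).Cusp, ((model ℚ).cusps U).IsRational c) ∧
        (model ℚ).IsNFCurve U ∧
        (∃ g : (model ℚ).regularUnits U,
          (model ℚ).IsNFRational U (((g : ((model ℚ).FunctionField U)ˣ)) : (model ℚ).FunctionField U) ∧
            (((g : ((model ℚ).FunctionField U)ˣ)) : (model ℚ).FunctionField U)
              ∉ Set.range (algebraMap ((model ℚ).base U) ((model ℚ).FunctionField U))) ∧
        Units.map (algebraMap ((model ℚ).base U) ((model ℚ).FunctionField U) : _ →* _) c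
          ∈ (model ℚ).regularUnits U ∧
        ∃ y : (model ℚ).Point U, (model ℚ).IsNFPoint U y :=
  fun U Ux X x _ => ⟨trivial, trivial, trivial, isCyclotomePresentation ℚ Ux X trivial x,
    isKummerFaithful_rat, isRational ℚ U, trivial, exists_nonconstant_unit ℚ U, Subgroup.mem_top _,
    ⟨PUnit.unit, trivial⟩⟩

/-- **F-0343 FAILS at this carrier over a Kummer-faithful base** (f-078's mechanism: `κ_U(X) = 0` restricts to
`0` on every cuspidal inertia group, yet `X` is nonconstant): with `κ_U := 1` a premise-firing carrier for
F-0345 is a counter-model to F-0343. [cite: MochizukiAbsTopIII2015, Prop 1.6 (iii) p.35] -/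
theorem not_prop_1_6_iii_units (hk : IsKummerFaithful k) : ¬ Prop_1_6_iii_units (model k) := by
  intro h
  refine unitX_not_mem_range (k := k) PUnit.unit ((h PUnit.unit PUnit.unit PUnit.unit trivial trivial
    PUnit.unit trivial (isCyclotomePresentation k _ _ _ _) hk (isRational k PUnit.unit) (unitX k _)).mp
    fun c => ?_)
  rw [toAdd_kummer]
  exact geomCyclotomeH1Res_zero _ _ _

/-- **F-0344 FAILS at this carrier over a Kummer-faithful base** (`X` is a nonconstant NF-rational unit, yet no
positive multiple of `κ_U(X) = 0` has a non-zero restriction). [cite: MochizukiAbsTopIII2015, Prop 1.8 (i) p.36] -/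
theorem not_prop_1_8_i_units (hk : IsKummerFaithful k) : ¬ Prop_1_8_i_units (model k) := by
  intro h
  obtain ⟨n, -, x₁, x₂, -, -, -, hne⟩ := (h PUnit.unit PUnit.unit PUnit.unit trivial trivial
    PUnit.unit trivial (isCyclotomePresentation k _ _ _ _) hk (isRational k PUnit.unit) trivial
    (unitX k _)).mp ⟨trivial, unitX_not_mem_range (k := k) PUnit.unit⟩
  refine hne ?_
  rw [toAdd_kummer, smul_zero]
  exact geomCyclotomeH1Res_zero _ _ _

/-- The three rows at the premise-firing carrier over `ℚ`, in one term: F-0345 HOLDS, F-0343 and F-0344 FAIL.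
[cite: MochizukiAbsTopIII2015, Prop 1.8 p.36] -/
theorem prop_1_8_ii_units_and_not_others_rat :
    Prop_1_8_ii_units (model ℚ) ∧ ¬ Prop_1_6_iii_units (model ℚ) ∧ ¬ Prop_1_8_i_units (model ℚ) :=
  ⟨prop_1_8_ii_units ℚ, not_prop_1_6_iii_units ℚ isKummerFaithful_rat,
    not_prop_1_8_i_units ℚ isKummerFaithful_rat⟩

end KummerUnitsNFToyCarrier

end Literature.AnabelianGeometry.AbsoluteAnabelian.AbsTopIII

end
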